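import Summits.QuantumFields.YangMills.Theorems.FluctuationComparisonRegPrIntLS2BetaCurlBudgetProfiled
import Summits.QuantumFields.YangMills.Theorems.FluctuationComparisonRegPrIntLS2BetaCovariantOscillationRegUpClosed
import HarnessLib

/-!
# S2β · (SCT″-c)₁ — «THE c₁ LETTER WITH THE OSCILLATION LETTER FROM THE (REG-UP)′ KNOT»: ✓p840789 `c1Budget_profiled`'s covariant-oscillation binders `hOSC`∕`hO0`
# (C₇b's letter with a level constant `Olev`) INHABITED by px12 g27's knot ✓p840777 `hOSC_regUp_closed` at every level `k := i < K − J` (`N := 2`, `Xd := X`), its loop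
# and plaquette classes (`α l`, `δ l`, index `l`, all-`l` guards) READ OFF the station's (BKG) binder (`α l := if l < K−J then ((d+2)L)²∕4·θ_l else 0`, `δ l := 2θ_l`,
# `θ_l := (C_B+1)α·L^{2l}·(L⁻¹)^{2(K−J)}`, ✓p839707 §1), with `Olev (i+1) := O_i` = the knot's explicit oscillation constant — so that the R-row of the c₁ letter displays
# ONLY the knot's PHYSICAL letters {`ε` (line recursion), `r` (one-step second-order remainders), `c₀ k` (the `L^k`-word oscillation of `X 0`), the window family `hwin`,
# radii `ρr`∕`a₀`} and the O-PROFILE arithmetic letter `hOlev : O_i ≤ o·q_i` (px12's ⧗`hOSC_regUp_profiled`∕`oscLetter_le_profile` supply it from level profiles).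

Cell `ym3-torus` (YM ladder rung R3 = continuum `SU(2)` Yang–Mills on the three-torus at fixed lattice data — a RUNG: NOT d = 4, NOT infinite volume, NOT a mass gap,
NOT Clay).  Width seat `ym-ust-20520-w4` (gen 29); crux `stmt-QuantumFields-20520`, LINE g18-1 S2β; piece (g1) (INTENT 2026-09-01T04:14:25Z; px12 g27 GO 04:15:46Z).
`--kind proof --supports stmt-QuantumFields-20520 --as helper`, count-neutral, DEFINITION-FREE (0 `def`, 0 `instance`, 0 `notation`, 0 `sorry`, default heartbeats).

WHAT IS PROVED (sorry-free; composition BY NAME).  ★★`oscKnot_letters` — from (BKG) + the two smallnesses + the knot's physical letters: the PAIR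
`(∀ i < K−J, 0 ≤ Olev (i+1)) ∧ ⟨✓p840622∕✓p840789's hOSC binder text with Olev := the O-lambda⟩` (the second conjunct = ✓p840777 at `k := i` BY `exact`; the first = the
letter bounds a norm); ★★★`c1Budget_oscKnot` = ✓p840789 `c1Budget_profiled` with `(Olev) (hO0) (hOSC)` REPLACED by `(ε r c₀ : ℕ → ℝ) (hε0 hεnn hε) (hwin) (hc₀nn hc₀) (hr0 hr)`
(✓p840777's binder texts at `N := 2`, `Xd := X`, quantified over the level) and `hOlev` re-addressed to the explicit `O_i` — `obtain ⟨hO0, hOSC⟩ := oscKnot_letters …; exact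
c1Budget_profiled …`.  The O-lambda is a `match` on the level (`| kk + 1 => O_kk`), so `Olev (i+1)` is `O_i` by `rfl`.

DOMAIN LINE (plan (3) v4; architect px17 g23 03:56:06Z «(REG-UP)′ is closing by name»; px12 g27 04:09:15Z∕04:15:46Z).  After this file the c₁ letter at fixed station data displays:
(T) windows (⟸ ✓p836413), (BKG) + smallnesses, the size side `hMb`∕`hMbsq`∕`hMbm` (⟸ ✓p840608 C-M), the knot's PHYSICAL letters `ε`∕`r`∕`c₀`∕windows ((REG)@rep lineage:
`c₀` = Thm 2's gradient letter transported, `r` = one-step second-order remainders, `ε` = line recursion), the arithmetic profile `hOlev` (⟸ px12's ⧗PROFILED `hOSC_regUp_profiled`,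
one scale power), `hζc`, radii windows; `B8Thm2AtT3Members` a theorem for `L ≥ 5`, `hThm2S3` at `L = 3`. [Balaban1985Averaging] (19)–(20) p.21, Prop. 3 (121)–(125) p.36,
Prop. 4 (128)–(135) pp.37–38; [Balaban1985RegularSpaces] Thm 2 (1.36) p.83; [Balaban1987RG1] (0.11), (0.18) pp.253–255.

HONEST SCOPE.  Composition of landed letters plus elementary guards; nothing of Bałaban's renormalisation-group analysis is asserted or proved; every displayed letter is a
HYPOTHESIS or others'; GAP♯∘ (`stub_uniformFibreGapOrbit`, registry 3732b7df UNTOUCHED, 0∕5), S2β, the five registered stubs, crux 20520, 19936, 19200 and `YM3TorusSU2`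
are NOT proved; no registered stub is closed; rung R3 — NOT d = 4, NOT infinite volume, NOT a mass gap, NOT Clay; the Yang–Mills mass gap is NOT proved.
-/

set_option autoImplicit false

noncomputable section

open scoped Matrix.Norms.L2Operator
open Finset

namespace Summit.QuantumFields.YangMills.Theorems.FluctuationComparisonRegPrIntLS2BetaCurlBudgetOscKnot

open Literature.MathematicalPhysics.QuantumFieldTheory.Balaban1983to89
open Literature.MathematicalPhysics.QuantumFieldTheory.Balaban1983to89.T4Continuum
open Literature.MathematicalPhysics.QuantumFieldTheory.Balaban1983to89.T3ContinuumYM3Torus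
open Literature.MathematicalPhysics.QuantumFieldTheory.Balaban1983to89.T3LevelShift
open Literature.MathematicalPhysics.QuantumFieldTheory.Balaban1983to89.T3TiltDescent
open Literature.MathematicalPhysics.QuantumFieldTheory.Balaban1983to89.T3UnitLawDensityEML (ℰp)
open Literature.MathematicalPhysics.QuantumFieldTheory.Balaban1983to89.T4HaarSU2ExpChart (expPoint)
open Literature.MathematicalPhysics.QuantumFieldTheory.Balaban1983to89.T4ExpWindowSmallField (logVec)
open Literature.MathematicalPhysics.QuantumFieldTheory.Balaban1983to89.HaarExponentialChart
open Literature.MathematicalPhysics.QuantumFieldTheory.Balaban1983to89.HaarExponentialChart.IsChartRep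
open Literature.MathematicalPhysics.QuantumFieldTheory.Balaban1983to89.BlockAveraging (Idx blockAvg avgFun loopHol)
open Literature.MathematicalPhysics.QuantumFieldTheory.Balaban1983to89.ExpMeanLog (expMeanLogSU deltaSU)
open Literature.MathematicalPhysics.QuantumFieldTheory.Balaban1983to89.BlockAveragingEMLLinearisedBackground (covWalkSum)
open Literature.MathematicalPhysics.QuantumFieldTheory.Balaban1983to89.B10Eq47AxialChi (shiftN)
open Literature.MathematicalPhysics.QuantumFieldTheory.Balaban1983to89.B14.Eq22Determines (blockIter)
open Literature.MathematicalPhysics.QuantumFieldTheory.Balaban1983to89.B10Eq27TorusAxialLog (rel)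
open Literature.MathematicalPhysics.QuantumFieldTheory.Balaban1983to89.B10Eq18SigmaSU2 (su2Coord)
open Literature.MathematicalPhysics.QuantumFieldTheory.Balaban1983to89.B10Eq18SigmaSU2Haar (rev)
open Literature.MathematicalPhysics.QuantumLattice (su2Quat)
open Summit.QuantumFields.YangMills.Theorems.FluctuationComparisonRegPrIntLS2BetaChartReadDescentOntoExpPoint (su2Coord_rev_mem_lie)
open Summit.QuantumFields.YangMills.Theorems.FluctuationComparisonRegPrIntLS2BetaCurlBudgetProfiled (c1Budget_profiled)
open Summit.QuantumFields.YangMills.Theorems.FluctuationComparisonRegPrIntLS2BetaCovariantOscillationRegUpClosed (hOSC_regUp_closed)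
open Literature.MathematicalPhysics.QuantumFieldTheory.Balaban1983to89.B10Eq47AxialChi (rowProd)
open Summit.QuantumFields.YangMills.Theorems.FluctuationComparisonRegPrIntLS2BetaChartReadGaugeCovariance (conj_mem_lie)
open Summit.QuantumFields.YangMills.Theorems.FluctuationComparisonRegPrIntLS2BetaSourceClassesOfBkg (plaqSmall_iter_of_bkg dist1_loopHol_iter_le_of_bkg bkgClass_nonneg bkgClass_lt_two_mul bkgClass_le_base)
open Literature.MathematicalPhysics.QuantumFieldTheory.Balaban1983to89.ExpMeanLog (deltaSU_pos)

variable (F : T3Family)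

/-- ★★ **THE OSCILLATION LETTER FROM THE KNOT, CLASSES FROM (BKG)** — ✓p840777 `hOSC_regUp_closed` at every level `i < K − J` (`N := 2`, `Xd := X`) with its
loop∕plaquette classes and all-`l` guards fed from (BKG); returns ✓p840789's `hO0` ∧ `hOSC` binder texts at `Olev := ` the O-lambda.
[cite: Balaban1985Averaging, (19)-(20) p.21, Prop. 3 (121)-(125) p.36, Prop. 4 (128)-(135) pp.37-38] -/
theorem oscKnot_letters {J K : ℕ}
    (U₀ : GaugeField (F.P K) 0 (Matrix.specialUnitaryGroup (Fin 2) ℂ))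
    (X : (i : ℕ) → PBond (F.P K) i → (specialUnitaryLogChart (Fin 2)).lie)
    (C_B α : ℝ) (hCB : 0 ≤ C_B) (hα : 0 < α)
    (hBKG : ∀ t, t ≤ K - J → ∀ p : Plaq (F.P K) t,
      dist1 (GaugeField.plaqHol (Averaging.iter (fun k => BlockAveraging.blockAvg (P := F.P K) (j := k) ℰp) t U₀) p) ≤
        C_B * α * (F.L : ℝ) ^ (2 * t) * ((F.L : ℝ)⁻¹) ^ (2 * (K - J)))
    (h24 : (((((F.P K).d + 2) * (F.P K).L : ℕ) : ℝ) ^ 2 / 4) * ((C_B + 1) * α) ≤ 1 / 24)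
    (hSU : (((((F.P K).d + 2) * (F.P K).L : ℕ) : ℝ) ^ 2 / 4) * ((C_B + 1) * α) < deltaSU (Fin 2))
    {ρr : ℝ} (hρ0 : 0 < ρr) (hρr : ρr ≤ innerRadius (specialUnitaryLogChart (Fin 2)))
    {a₀ : ℝ} (ha0 : 0 < a₀) (ha : 100 * (((((F.P K).d + 2) * (F.P K).L : ℕ) : ℝ) * (Real.exp a₀ - 1)) ≤ ρr)
    (hρα : 4 * ((((((F.P K).d + 2) * (F.P K).L : ℕ) : ℝ) ^ 2 / 4) * (2 * ((C_B + 1) * α))) ≤ ρr)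
    (ε r c₀ : ℕ → ℝ)
    (hε0 : ε 0 = 0) (hεnn : ∀ i, 0 ≤ ε i) (hε : ∀ i, i < K - J → ((F.P K).L : ℝ) * ε i + 2 * (fun l : ℕ => if l < K - J then (((((F.P K).d + 2) * (F.P K).L : ℕ) : ℝ) ^ 2 / 4) * ((C_B + 1) * α * (F.L : ℝ) ^ (2 * l) * ((F.L : ℝ)⁻¹) ^ (2 * (K - J))) else 0) i ≤ ε (i + 1))
    (hwin : ∀ k, k < K - J → ∀ i, i < k → 100 * (((((F.P K).d + 2) * (F.P K).L : ℕ) : ℝ) * (((((F.P K).d - 1 : ℕ) : ℝ) * ((2 * (F.P K).L : ℕ) : ℝ) * (fun l : ℕ => 2 * ((C_B + 1) * α * (F.L : ℝ) ^ (2 * l) * ((F.L : ℝ)⁻¹) ^ (2 * (K - J)))) i) + (((((F.P K).d - 1 : ℕ) : ℝ) * ((2 * (F.P K).L : ℕ) : ℝ) * (fun l : ℕ => 2 * ((C_B + 1) * α * (F.L : ℝ) ^ (2 * l) * ((F.L : ℝ)⁻¹) ^ (2 * (K - J)))) i) + ((((F.P K).L ^ (k - i) : ℕ) : ℝ) * (2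 * ε i + (fun l : ℕ => 2 * ((C_B + 1) * α * (F.L : ℝ) ^ (2 * l) * ((F.L : ℝ)⁻¹) ^ (2 * (K - J)))) i))))) ≤ ρr)
    (hc₀nn : ∀ k, 0 ≤ (F.L : ℝ) ^ k * c₀ k)
    (hc₀ : ∀ k, k < K - J → ∀ (μ : Fin (F.P K).d) (b : PBond (F.P K) 0), ‖(((fun b : PBond (F.P K) 0 => (⟨((rowProd U₀ b.src μ ((F.P K).L ^ k) : Matrix.specialUnitaryGroup (Fin 2) ℂ) : Matrix (Fin 2) (Fin 2) ℂ) * (((X 0) (b.translate (Site.scaleTo k ((0 : Site (F.P K) k).shift μ))) : (specialUnitaryLogChart (Fin 2)).lie) : Matrix (Fin 2) (Fin 2) ℂ) * star ((rowProd U₀ b.src μ ((F.P K).L ^ k) : Matrix.specialUnitaryGroup (Fin 2) ℂ) : Matrix (Fin 2) (Fin 2) ℂ), conj_mem_lie (rowProd U₀ b.src μ ((F.P K).L ^ k)) ((X 0) (b.translate (Site.scaleTo k ((0 : Site (F.P K) k).shift μ))))⟩ : (specialUnitaryLogChart (Fin 2)).lie)) b : (specialUnitaryLogChart (Fin 2)).lie)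 : Matrix (Fin 2) (Fin 2) ℂ) - (((X 0) b : (specialUnitaryLogChart (Fin 2)).lie) : Matrix (Fin 2) (Fin 2) ℂ)‖ ≤ (F.L : ℝ) ^ k * c₀ k)
    (hr0 : ∀ l, 0 ≤ r l)
    (hr : ∀ i, i < K - J → ∀ c' : PBond (F.P K) (i + 1),
      ‖((X (i + 1) c' : (specialUnitaryLogChart (Fin 2)).lie) : Matrix (Fin 2) (Fin 2) ℂ) - (((fderiv ℝ (fun (B : PBond (F.P K) i → (specialUnitaryLogChart (Fin 2)).lie) (c' : PBond (F.P K) (i + 1)) => (isChartRep_specialUnitaryGroup (n := Fin 2)).logChart (avgFun (expMeanLogSU (n := Fin 2)) (fun c => (isChartRep_specialUnitaryGroup (n := Fin 2)).expChart (B c) * (Averaging.iter (fun i => blockAvg (P := F.P K) (j := i) (expMeanLogSU (n := Fin 2))) i U₀) c) c' * (avgFun (expMeanLogSU (n := Fin 2)) ((Averaging.iter (fun i => blockAvg (P := F.P K) (j := i) (expMeanLogSU (n := Fin 2))) i U₀)) c')⁻¹)) 0) (X i) c' : (specialUnitaryLogChart (Fin 2)).lie) : Matrix (Fin 2) (Fin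 2) ℂ)‖ ≤ r (i + 1))
 :
    (∀ i, i < K - J → 0 ≤ (fun n : ℕ => match n with
            | 0 => (0 : ℝ)
            | kk + 1 => 2 * ((((F.P K).d : ℕ) : ℝ) * ((3 * (F.P K).L : ℕ) : ℝ)) * (((2 * ε kk * (((1 + 4 * (((F.P K).d + 2 : ℕ) : ℝ)) * Real.exp ((((F.P K).d + 2 : ℕ) : ℝ) * (422 + 1616 * (((F.P K).d + 2 : ℕ) : ℝ)) * ∑ j ∈ Finset.range kk, (fun l : ℕ => if l < K - J then (((((F.P K).d + 2) * (F.P K).L : ℕ) : ℝ) ^ 2 / 4) * ((C_B + 1) * α * (F.L : ℝ) ^ (2 * l) * ((F.L : ℝ)⁻¹) ^ (2 * (K - J))) else 0) j)) * ((F.P K).L : ℝ) ^ kk * ‖X 0‖) + (∑ i ∈ Finset.range kk, ((1 + 4 * (((F.P K).d + 2 : ℕ) : ℝ)) * Real.exp ((((F.P K).d + 2 : ℕ) : ℝ) * (422 + 1616 * (((F.P K).d + 2 : ℕ) : ℝ)) * ∑ j ∈ Finset.range kk, (fun l : ℕ => if l < K - J then (((((F.P K).d + 2) * (F.P K).L :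 ℕ) : ℝ) ^ 2 / 4) * ((C_B + 1) * α * (F.L : ℝ) ^ (2 * l) * ((F.L : ℝ)⁻¹) ^ (2 * (K - J))) else 0) j)) * ((F.P K).L : ℝ) ^ (kk - 1 - i) * ((2 * (67 * (((((F.P K).d + 2) * (F.P K).L : ℕ) : ℝ) * (((((F.P K).d - 1 : ℕ) : ℝ) * ((2 * (F.P K).L : ℕ) : ℝ) * (fun l : ℕ => 2 * ((C_B + 1) * α * (F.L : ℝ) ^ (2 * l) * ((F.L : ℝ)⁻¹) ^ (2 * (K - J)))) i) + (((((F.P K).d - 1 : ℕ) : ℝ) * ((2 * (F.P K).L : ℕ) : ℝ) * (fun l : ℕ => 2 * ((C_B + 1) * α * (F.L : ℝ) ^ (2 * l) * ((F.L : ℝ)⁻¹) ^ (2 * (K - J)))) i) + ((((F.P K).L ^ (kk - i) : ℕ) : ℝ) * (2 * ε i + (fun l : ℕ => 2 * ((C_B + 1) * α * (F.L : ℝ) ^ (2 * l) * ((F.L : ℝ)⁻¹) ^ (2 * (K - J)))) i)))))) / a₀) * (((1 + 4 * (((F.P K).d + 2 : ℕ) : ℝ)) * Real.exp ((((F.P K).d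 + 2 : ℕ) : ℝ) * (422 + 1616 * (((F.P K).d + 2 : ℕ) : ℝ)) * ∑ j ∈ Finset.range kk, (fun l : ℕ => if l < K - J then (((((F.P K).d + 2) * (F.P K).L : ℕ) : ℝ) ^ 2 / 4) * ((C_B + 1) * α * (F.L : ℝ) ^ (2 * l) * ((F.L : ℝ)⁻¹) ^ (2 * (K - J))) else 0) j)) * ((F.P K).L : ℝ) ^ i))) * ‖X 0‖) + (((1 + 4 * (((F.P K).d + 2 : ℕ) : ℝ)) * Real.exp ((((F.P K).d + 2 : ℕ) : ℝ) * (422 + 1616 * (((F.P K).d + 2 : ℕ) : ℝ)) * ∑ j ∈ Finset.range kk, (fun l : ℕ => if l < K - J then (((((F.P K).d + 2) * (F.P K).L : ℕ) : ℝ) ^ 2 / 4) * ((C_B + 1) * α * (F.L : ℝ) ^ (2 * l) * ((F.L : ℝ)⁻¹) ^ (2 * (K - J))) else 0) j)) * ((F.P K).L : ℝ) ^ kk) * ((F.L : ℝ) ^ kk * c₀ kk)) + 2 * (∑ i ∈ Finset.range kk, ((1 + 4 * (((F.P K).d + 2 : ℕ) : ℝ)) * Real.exp ((((F.P K).d + 2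 : ℕ) : ℝ) * (422 + 1616 * (((F.P K).d + 2 : ℕ) : ℝ)) * ∑ j ∈ Finset.range kk, (fun l : ℕ => if l < K - J then (((((F.P K).d + 2) * (F.P K).L : ℕ) : ℝ) ^ 2 / 4) * ((C_B + 1) * α * (F.L : ℝ) ^ (2 * l) * ((F.L : ℝ)⁻¹) ^ (2 * (K - J))) else 0) j)) * ((F.P K).L : ℝ) ^ (kk - 1 - i) * r (i + 1)))) (i + 1)) ∧
    (∀ μ ν : Fin (F.P K).d, μ < ν → ∀ i, i < K - J → ∀ (y' : Site (F.P K) (i + 1)) (b b' : PBond (F.P K) i), (blockOf b.src = y' ∨ blockOf b.src = y'.shift μ ∨ blockOf b.src = y'.shift ν ∨ blockOf b.src = (y'.shift μ).shift ν) → (blockOf b'.src = y' ∨ blockOf b'.src = y'.shift μ ∨ blockOf b'.src = y'.shift ν ∨ blockOf b'.src = (y'.shift μ).shift ν) → b.dir = b'.dir →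
      ‖(((T4AxialGaugeSmallField.axialGauge (Averaging.iter (fun k => BlockAveraging.blockAvg (P := F.P K) (j := k) ℰp) i U₀) (fun κ : Fin (F.P K).d => (((emb y' κ).val : ℕ) : ℤ) - ((((F.P K).L - 1) / 2 : ℕ) : ℤ)) (fun κ : Fin (F.P K).d => (((emb y' κ).val : ℕ) : ℤ) + (((if κ = μ then ((F.P K).L : ℤ) else 0) + (if κ = ν then ((F.P K).L : ℤ) else 0)) + ((((F.P K).L - 1) / 2 : ℕ) : ℤ)) + 1)) b.src : Matrix.specialUnitaryGroup (Fin 2) ℂ) : Matrix (Fin 2) (Fin 2) ℂ) * ((X i b : (specialUnitaryLogChart (Fin 2)).lie) : Matrix (Fin 2) (Fin 2) ℂ) * star (((T4AxialGaugeSmallField.axialGauge (Averaging.iter (fun k => BlockAveraging.blockAvg (P := F.P K) (j := k) ℰp) i U₀) (fun κ : Fin (F.P K).d => (((emb y' κ).val : ℕ) : ℤ) - ((((F.P K).L - 1) / 2 : ℕ) : ℤ)) (fun κ : Fin (F.P K).d => (((emb y' κ).val : ℕ) : ℤ) + (((if κ = μ then ((F.P K).L : ℤ) else 0) + (if κ =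 ν then ((F.P K).L : ℤ) else 0)) + ((((F.P K).L - 1) / 2 : ℕ) : ℤ)) + 1)) b.src : Matrix.specialUnitaryGroup (Fin 2) ℂ) : Matrix (Fin 2) (Fin 2) ℂ) -
        ((((T4AxialGaugeSmallField.axialGauge (Averaging.iter (fun k => BlockAveraging.blockAvg (P := F.P K) (j := k) ℰp) i U₀) (fun κ : Fin (F.P K).d => (((emb y' κ).val : ℕ) : ℤ) - ((((F.P K).L - 1) / 2 : ℕ) : ℤ)) (fun κ : Fin (F.P K).d => (((emb y' κ).val : ℕ) : ℤ) + (((if κ = μ then ((F.P K).L : ℤ) else 0) + (if κ = ν then ((F.P K).L : ℤ) else 0)) + ((((F.P K).L - 1) / 2 : ℕ) : ℤ)) + 1)) b'.src : Matrix.specialUnitaryGroup (Fin 2) ℂ) : Matrix (Fin 2) (Fin 2) ℂ) * ((X i b' : (specialUnitaryLogChart (Fin 2)).lie) : Matrix (Fin 2) (Fin 2) ℂ) * star (((T4AxialGaugeSmallField.axialGauge (Averaging.iter (fun k => BlockAveraging.blockAvg (P := F.P K) (j := k) ℰp) i U₀) (fun κ : Fin (F.P K).d => (((emb y' κ).val :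 ℕ) : ℤ) - ((((F.P K).L - 1) / 2 : ℕ) : ℤ)) (fun κ : Fin (F.P K).d => (((emb y' κ).val : ℕ) : ℤ) + (((if κ = μ then ((F.P K).L : ℤ) else 0) + (if κ = ν then ((F.P K).L : ℤ) else 0)) + ((((F.P K).L - 1) / 2 : ℕ) : ℤ)) + 1)) b'.src : Matrix.specialUnitaryGroup (Fin 2) ℂ) : Matrix (Fin 2) (Fin 2) ℂ))‖ ≤
        (fun n : ℕ => match n with
              | 0 => (0 : ℝ)
              | kk + 1 => 2 * ((((F.P K).d : ℕ) : ℝ) * ((3 * (F.P K).L : ℕ) : ℝ)) * (((2 * ε kk * (((1 + 4 * (((F.P K).d + 2 : ℕ) : ℝ)) * Real.exp ((((F.P K).d + 2 : ℕ) : ℝ) * (422 + 1616 * (((F.P K).d + 2 : ℕ) : ℝ)) * ∑ j ∈ Finset.range kk, (fun l : ℕ => if l < K - J then (((((F.P K).d + 2) * (F.P K).L : ℕ) : ℝ) ^ 2 / 4) * ((C_B + 1) * α * (F.L : ℝ) ^ (2 * l) * ((F.L : ℝ)⁻¹) ^ (2 * (K - J))) else 0) j)) * ((F.P K).L : ℝ)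 ^ kk * ‖X 0‖) + (∑ i ∈ Finset.range kk, ((1 + 4 * (((F.P K).d + 2 : ℕ) : ℝ)) * Real.exp ((((F.P K).d + 2 : ℕ) : ℝ) * (422 + 1616 * (((F.P K).d + 2 : ℕ) : ℝ)) * ∑ j ∈ Finset.range kk, (fun l : ℕ => if l < K - J then (((((F.P K).d + 2) * (F.P K).L : ℕ) : ℝ) ^ 2 / 4) * ((C_B + 1) * α * (F.L : ℝ) ^ (2 * l) * ((F.L : ℝ)⁻¹) ^ (2 * (K - J))) else 0) j)) * ((F.P K).L : ℝ) ^ (kk - 1 - i) * ((2 * (67 * (((((F.P K).d + 2) * (F.P K).L : ℕ) : ℝ) * (((((F.P K).d - 1 : ℕ) : ℝ) * ((2 * (F.P K).L : ℕ) : ℝ) * (fun l : ℕ => 2 * ((C_B + 1) * α * (F.L : ℝ) ^ (2 * l) * ((F.L : ℝ)⁻¹) ^ (2 * (K - J)))) i) + (((((F.P K).d - 1 : ℕ) : ℝ) * ((2 * (F.P K).L : ℕ) : ℝ) * (fun l : ℕ => 2 * ((C_B + 1) * α * (F.L : ℝ) ^ (2 * l) * ((F.L : ℝ)⁻¹) ^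 (2 * (K - J)))) i) + ((((F.P K).L ^ (kk - i) : ℕ) : ℝ) * (2 * ε i + (fun l : ℕ => 2 * ((C_B + 1) * α * (F.L : ℝ) ^ (2 * l) * ((F.L : ℝ)⁻¹) ^ (2 * (K - J)))) i)))))) / a₀) * (((1 + 4 * (((F.P K).d + 2 : ℕ) : ℝ)) * Real.exp ((((F.P K).d + 2 : ℕ) : ℝ) * (422 + 1616 * (((F.P K).d + 2 : ℕ) : ℝ)) * ∑ j ∈ Finset.range kk, (fun l : ℕ => if l < K - J then (((((F.P K).d + 2) * (F.P K).L : ℕ) : ℝ) ^ 2 / 4) * ((C_B + 1) * α * (F.L : ℝ) ^ (2 * l) * ((F.L : ℝ)⁻¹) ^ (2 * (K - J))) else 0) j)) * ((F.P K).L : ℝ) ^ i))) * ‖X 0‖) + (((1 + 4 * (((F.P K).d + 2 : ℕ) : ℝ)) * Real.exp ((((F.P K).d + 2 : ℕ) : ℝ) * (422 + 1616 * (((F.P K).d + 2 : ℕ) : ℝ)) * ∑ j ∈ Finset.range kk, (fun l : ℕ => if l < K - J then (((((F.P K).d + 2) * (F.P K).L : ℕ) : ℝ) ^ 2 / 4)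 * ((C_B + 1) * α * (F.L : ℝ) ^ (2 * l) * ((F.L : ℝ)⁻¹) ^ (2 * (K - J))) else 0) j)) * ((F.P K).L : ℝ) ^ kk) * ((F.L : ℝ) ^ kk * c₀ kk)) + 2 * (∑ i ∈ Finset.range kk, ((1 + 4 * (((F.P K).d + 2 : ℕ) : ℝ)) * Real.exp ((((F.P K).d + 2 : ℕ) : ℝ) * (422 + 1616 * (((F.P K).d + 2 : ℕ) : ℝ)) * ∑ j ∈ Finset.range kk, (fun l : ℕ => if l < K - J then (((((F.P K).d + 2) * (F.P K).L : ℕ) : ℝ) ^ 2 / 4) * ((C_B + 1) * α * (F.L : ℝ) ^ (2 * l) * ((F.L : ℝ)⁻¹) ^ (2 * (K - J))) else 0) j)) * ((F.P K).L : ℝ) ^ (kk - 1 - i) * r (i + 1)))) (i + 1)):= by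
  have hL2 : (2 : ℝ) ≤ (F.L : ℝ) := by exact_mod_cast F.hL.2
  have hL1 : (1 : ℝ) ≤ (F.L : ℝ) := by linarith
  have hL0 : (0 : ℝ) ≤ (F.L : ℝ) := by linarith
  have hCB1 : (0 : ℝ) ≤ C_B + 1 := by linarith
  have hpos : 0 < (C_B + 1) * α := by positivity
  have hKA0 : (0 : ℝ) ≤ (((((F.P K).d + 2) * (F.P K).L : ℕ) : ℝ) ^ 2 / 4) := by positivity
  have hδSU : 0 < deltaSU (Fin 2) := deltaSU_pos
  have hBKG' : ∀ t, t ≤ K - J → ∀ p : Plaq (F.P K) t,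
      dist1 (GaugeField.plaqHol (Averaging.iter (fun k => BlockAveraging.blockAvg (P := F.P K) (j := k) ℰp) t U₀) p) ≤
        (C_B + 1) * α * (F.L : ℝ) ^ (2 * t) * ((F.L : ℝ)⁻¹) ^ (2 * (K - J)) := by
    intro t ht p
    refine (hBKG t ht p).trans ?_
    have h0 : 0 ≤ α * (F.L : ℝ) ^ (2 * t) * ((F.L : ℝ)⁻¹) ^ (2 * (K - J)) :=
      mul_nonneg (mul_nonneg hα.le (pow_nonneg hL0 _)) (pow_nonneg (inv_nonneg.2 hL0) _)
    have h1 : C_B * α * (F.L : ℝ) ^ (2 * t) * ((F.L : ℝ)⁻¹) ^ (2 * (K - J)) =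
        C_B * (α * (F.L : ℝ) ^ (2 * t) * ((F.L : ℝ)⁻¹) ^ (2 * (K - J))) := by ring
    have h2 : (C_B + 1) * α * (F.L : ℝ) ^ (2 * t) * ((F.L : ℝ)⁻¹) ^ (2 * (K - J)) =
        (C_B + 1) * (α * (F.L : ℝ) ^ (2 * t) * ((F.L : ℝ)⁻¹) ^ (2 * (K - J))) := by ring
    rw [h1, h2]
    exact mul_le_mul_of_nonneg_right (by linarith) h0
  have hθ0 : ∀ l : ℕ, 0 ≤ ((C_B + 1) * α * (F.L : ℝ) ^ (2 * l) * ((F.L : ℝ)⁻¹) ^ (2 * (K - J))) := fun l => bkgClass_nonneg F (C_B + 1) α hCB1 hα.le l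
  have hθle : ∀ l, l < K - J → ((C_B + 1) * α * (F.L : ℝ) ^ (2 * l) * ((F.L : ℝ)⁻¹) ^ (2 * (K - J))) ≤ (C_B + 1) * α := fun l hl => bkgClass_le_base F (C_B + 1) α hCB1 hα.le hL1 hl.le
  -- the knot's loop class `α l := if l < K−J then kα·θ_l else 0` and its all-`l` guards
  have hα0' : ∀ l, 0 ≤ (fun l : ℕ => if l < K - J then (((((F.P K).d + 2) * (F.P K).L : ℕ) : ℝ) ^ 2 / 4) * ((C_B + 1) * α * (F.L : ℝ) ^ (2 * l) * ((F.L : ℝ)⁻¹) ^ (2 * (K - J))) else 0) l := by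
    intro l; dsimp only; split_ifs
    · exact mul_nonneg hKA0 (hθ0 l)
    · exact le_rfl
  have hα24' : ∀ l, (fun l : ℕ => if l < K - J then (((((F.P K).d + 2) * (F.P K).L : ℕ) : ℝ) ^ 2 / 4) * ((C_B + 1) * α * (F.L : ℝ) ^ (2 * l) * ((F.L : ℝ)⁻¹) ^ (2 * (K - J))) else 0) l ≤ 1 / 24 := by
    intro l; dsimp only; split_ifs with hl
    · have h := mul_le_mul_of_nonneg_left (hθle l hl) hKA0
      linarith
    · norm_num
  have hαδ' : ∀ l, (fun l : ℕ => if l < K - J then (((((F.P K).d + 2) * (F.P K).L : ℕ) : ℝ) ^ 2 / 4) * ((C_B + 1) * α * (F.L : ℝ) ^ (2 * l) * ((F.L : ℝ)⁻¹) ^ (2 * (K - J))) else 0) l < deltaSU (Fin 2) := by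
    intro l; dsimp only; split_ifs with hl
    · have h := mul_le_mul_of_nonneg_left (hθle l hl) hKA0
      linarith
    · exact hδSU
  have hα4' : ∀ l, 4 * (fun l : ℕ => if l < K - J then (((((F.P K).d + 2) * (F.P K).L : ℕ) : ℝ) ^ 2 / 4) * ((C_B + 1) * α * (F.L : ℝ) ^ (2 * l) * ((F.L : ℝ)⁻¹) ^ (2 * (K - J))) else 0) l ≤ ρr := by
    intro l; dsimp only; split_ifs with hl
    · have h := mul_le_mul_of_nonneg_left (hθle l hl) hKA0
      nlinarith [hρα, hθ0 l]
    · linarith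
  have hαU' : ∀ l, l < K - J → ∀ (c : PBond (F.P K) (l + 1)) (idx : Idx (F.P K)),
      dist1 (loopHol (Averaging.iter (fun k => BlockAveraging.blockAvg (P := F.P K) (j := k) ℰp) l U₀) c idx) ≤ (fun l : ℕ => if l < K - J then (((((F.P K).d + 2) * (F.P K).L : ℕ) : ℝ) ^ 2 / 4) * ((C_B + 1) * α * (F.L : ℝ) ^ (2 * l) * ((F.L : ℝ)⁻¹) ^ (2 * (K - J))) else 0) l := by
    intro l hl c idx
    dsimp only; rw [if_pos hl]
    exact dist1_loopHol_iter_le_of_bkg F U₀ (C_B + 1) α hCB1 hα.le hBKG' l hl c idx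
  -- the knot's plaquette class `δ l := 2θ_l`
  have hδ0' : ∀ l, 0 ≤ (fun l : ℕ => 2 * ((C_B + 1) * α * (F.L : ℝ) ^ (2 * l) * ((F.L : ℝ)⁻¹) ^ (2 * (K - J)))) l := fun l => mul_nonneg zero_le_two (hθ0 l)
  have hδ' : ∀ l, l < K - J → PlaqSmall ((fun l : ℕ => 2 * ((C_B + 1) * α * (F.L : ℝ) ^ (2 * l) * ((F.L : ℝ)⁻¹) ^ (2 * (K - J)))) l)
      (Averaging.iter (fun k => BlockAveraging.blockAvg (P := F.P K) (j := k) ℰp) l U₀) :=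
    plaqSmall_iter_of_bkg F U₀ (C_B + 1) α hBKG' (fun l : ℕ => 2 * ((C_B + 1) * α * (F.L : ℝ) ^ (2 * l) * ((F.L : ℝ)⁻¹) ^ (2 * (K - J)))) (fun n _ => bkgClass_lt_two_mul F (C_B + 1) α hpos (by linarith) n)
  -- a direction and the knot at every level `i < K − J`
  have hd3 : 0 < (F.P K).d := by show 0 < 3; norm_num
  have hknot : ∀ i, i < K - J → ∀ {μ ν : Fin (F.P K).d} (y' : Site (F.P K) (i + 1)) (b b' : PBond (F.P K) i),
      (blockOf b.src = y' ∨ blockOf b.src = y'.shift μ ∨ blockOf b.src = y'.shift ν ∨ blockOf b.src = (y'.shift μ).shift ν) →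
      (blockOf b'.src = y' ∨ blockOf b'.src = y'.shift μ ∨ blockOf b'.src = y'.shift ν ∨ blockOf b'.src = (y'.shift μ).shift ν) →
      b.dir = b'.dir → _ := fun i hi μ ν y' b b' hb hb' hdir =>
    hOSC_regUp_closed F (K := K) (k := i) (by have := F.hm; omega) U₀ X hα0' hα24' hαδ'
      (fun l hl c idx => hαU' l (lt_trans hl hi) c idx) hρ0 hρr hα4' hδ0' (fun l hl => hδ' l (lt_trans hl hi))
      hε0 hεnn (fun j hj => hε j (lt_trans hj hi)) (hwin i hi) ha0 ha (hc₀nn i) (hc₀ i hi) hr0 (fun j hj => hr j (lt_trans hj hi))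
      y' b b' hb hb' hdir
  refine ⟨?_, ?_⟩
  · -- hO0: the letter bounds a norm
    intro i hi
    exact (norm_nonneg _).trans (hknot i hi (μ := ⟨0, hd3⟩) (ν := ⟨0, hd3⟩) (blockOf (default : Site (F.P K) i))
      ⟨default, ⟨0, hd3⟩⟩ ⟨default, ⟨0, hd3⟩⟩ (Or.inl rfl) (Or.inl rfl) rfl)
  · -- hOSC
    intro μ ν _ i hi y' b b' hb hb' hdir
    exact hknot i hi y' b b' hb hb' hdir

/-- ★★★ **THE c₁ LETTER WITH THE OSCILLATION LETTER FROM THE KNOT** — ✓`c1Budget_profiled` ∘ ✓`oscKnot_letters`; see the module header.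
[cite: Balaban1985Averaging, Prop. 3 (123), Prop. 4 (128)-(135) pp.37-38; Balaban1985RegularSpaces, Thm 2 (1.36) p.83; Balaban1987RG1, (0.11), (0.18) pp.253-255] -/
theorem c1Budget_oscKnot {J K : ℕ} (hJK : J ≤ K) (Cst : ℝ) (hCst : 0 ≤ Cst)
    (U₀ : GaugeField (F.P K) 0 (Matrix.specialUnitaryGroup (Fin 2) ℂ)) (ζ : PBond (F.P K) 0 → EuclideanSpace ℝ (Fin 3))
    (X : (i : ℕ) → PBond (F.P K) i → (specialUnitaryLogChart (Fin 2)).lie)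
    (hXdef : X = fun (i : ℕ) (b : PBond (F.P K) i) =>
      (⟨su2Coord (rev (logVec (su2Quat (Averaging.iter (fun k => BlockAveraging.blockAvg (P := F.P K) (j := k) ℰp) i (fun ℓ => expPoint (ζ ℓ) * U₀ ℓ : GaugeField (F.P K) 0 (Matrix.specialUnitaryGroup (Fin 2) ℂ)) b * (Averaging.iter (fun k => BlockAveraging.blockAvg (P := F.P K) (j := k) ℰp) i U₀ b)⁻¹)))), su2Coord_rev_mem_lie _⟩ : (specialUnitaryLogChart (Fin 2)).lie))
    (Mg : ℕ → ℝ) (hMg : ∀ t, t ≤ K - J → ∀ b : PBond (F.P K) t,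
      ‖logVec (su2Quat (Averaging.iter (fun k => BlockAveraging.blockAvg (P := F.P K) (j := k) ℰp) t (fun ℓ => expPoint (ζ ℓ) * U₀ ℓ : GaugeField (F.P K) 0 (Matrix.specialUnitaryGroup (Fin 2) ℂ)) b * (Averaging.iter (fun k => BlockAveraging.blockAvg (P := F.P K) (j := k) ℰp) t U₀ b)⁻¹))‖ ≤ Mg t)
    (hMg4 : ∀ t, t ≤ K - J → Mg t ≤ 1 / 4)
    (C_B α : ℝ) (hCB : 0 ≤ C_B) (hα : 0 < α)
    (hBKG : ∀ t, t ≤ K - J → ∀ p : Plaq (F.P K) t,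
      dist1 (GaugeField.plaqHol (Averaging.iter (fun k => BlockAveraging.blockAvg (P := F.P K) (j := k) ℰp) t U₀) p) ≤
        C_B * α * (F.L : ℝ) ^ (2 * t) * ((F.L : ℝ)⁻¹) ^ (2 * (K - J)))
    (h24 : ((((F.P K).d + 2) * (F.P K).L : ℕ) : ℝ) ^ 2 / 4 * ((C_B + 1) * α) ≤ 1 / 24)
    (hSU : ((((F.P K).d + 2) * (F.P K).L : ℕ) : ℝ) ^ 2 / 4 * ((C_B + 1) * α) < deltaSU (Fin 2))
    {ρr : ℝ} (hρ0 : 0 < ρr) (hρr : ρr ≤ innerRadius (specialUnitaryLogChart (Fin 2)))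
    {a₀ : ℝ} (ha0 : 0 < a₀) (ha : 100 * (((((F.P K).d + 2) * (F.P K).L : ℕ) : ℝ) * (Real.exp a₀ - 1)) ≤ ρr)
    (Mb : ℕ → ℝ) (hMb0 : ∀ i, i < K - J → 0 ≤ Mb i) (hMb : ∀ i, i < K - J → ∀ b : PBond (F.P K) i, ‖X i b‖ ≤ Mb i) (hMb16 : ∀ i, i < K - J → 16 * Mb i ≤ a₀)
    (ε r c₀ : ℕ → ℝ)
    (hε0 : ε 0 = 0) (hεnn : ∀ i, 0 ≤ ε i) (hε : ∀ i, i < K - J → ((F.P K).L : ℝ) * ε i + 2 * (fun l : ℕ => if l < K - J then (((((F.P K).d + 2) * (F.P K).L : ℕ) : ℝ) ^ 2 / 4) * ((C_B + 1) * α * (F.L : ℝ) ^ (2 * l) * ((F.L : ℝ)⁻¹) ^ (2 * (K - J))) else 0) i ≤ ε (i + 1))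
    (hwin : ∀ k, k < K - J → ∀ i, i < k → 100 * (((((F.P K).d + 2) * (F.P K).L : ℕ) : ℝ) * (((((F.P K).d - 1 : ℕ) : ℝ) * ((2 * (F.P K).L : ℕ) : ℝ) * (fun l : ℕ => 2 * ((C_B + 1) * α * (F.L : ℝ) ^ (2 * l) * ((F.L : ℝ)⁻¹) ^ (2 * (K - J)))) i) + (((((F.P K).d - 1 : ℕ) : ℝ) * ((2 * (F.P K).L : ℕ) : ℝ) * (fun l : ℕ => 2 * ((C_B + 1) * α * (F.L : ℝ) ^ (2 * l) * ((F.L : ℝ)⁻¹) ^ (2 * (K - J)))) i) + ((((F.P K).L ^ (k - i) : ℕ) : ℝ) * (2 * ε i + (fun l : ℕ => 2 * ((C_B + 1) * α * (F.L : ℝ) ^ (2 * l) * ((F.L : ℝ)⁻¹) ^ (2 * (K - J)))) i))))) ≤ ρr)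
    (hc₀nn : ∀ k, 0 ≤ (F.L : ℝ) ^ k * c₀ k)
    (hc₀ : ∀ k, k < K - J → ∀ (μ : Fin (F.P K).d) (b : PBond (F.P K) 0), ‖(((fun b : PBond (F.P K) 0 => (⟨((rowProd U₀ b.src μ ((F.P K).L ^ k) : Matrix.specialUnitaryGroup (Fin 2) ℂ) : Matrix (Fin 2) (Fin 2) ℂ) * (((X 0) (b.translate (Site.scaleTo k ((0 : Site (F.P K) k).shift μ))) : (specialUnitaryLogChart (Fin 2)).lie) : Matrix (Fin 2) (Fin 2) ℂ) * star ((rowProd U₀ b.src μ ((F.P K).L ^ k) : Matrix.specialUnitaryGroup (Fin 2) ℂ) : Matrix (Fin 2) (Fin 2) ℂ), conj_mem_lie (rowProd U₀ b.src μ ((F.P K).L ^ k)) ((X 0) (b.translate (Site.scaleTo k ((0 : Site (F.P K) k).shift μ))))⟩ : (specialUnitaryLogChart (Fin 2)).lie)) b : (specialUnitaryLogChart (Fin 2)).lie) : Matrix (Fin 2) (Fin 2) ℂ) - (((X 0) b : (specialUnitaryLogChart (Fin 2)).lie) : Matrix (Fin 2) (Fin 2) ℂ)‖ ≤ (F.L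 : ℝ) ^ k * c₀ k)
    (hr0 : ∀ l, 0 ≤ r l)
    (hr : ∀ i, i < K - J → ∀ c' : PBond (F.P K) (i + 1),
      ‖((X (i + 1) c' : (specialUnitaryLogChart (Fin 2)).lie) : Matrix (Fin 2) (Fin 2) ℂ) - (((fderiv ℝ (fun (B : PBond (F.P K) i → (specialUnitaryLogChart (Fin 2)).lie) (c' : PBond (F.P K) (i + 1)) => (isChartRep_specialUnitaryGroup (n := Fin 2)).logChart (avgFun (expMeanLogSU (n := Fin 2)) (fun c => (isChartRep_specialUnitaryGroup (n := Fin 2)).expChart (B c) * (Averaging.iter (fun i => blockAvg (P := F.P K) (j := i) (expMeanLogSU (n := Fin 2))) i U₀) c) c' * (avgFun (expMeanLogSU (n := Fin 2)) ((Averaging.iter (fun i => blockAvg (P := F.P K) (j := i) (expMeanLogSU (n := Fin 2))) i U₀)) c')⁻¹)) 0) (X i) c' : (specialUnitaryLogChart (Fin 2)).lie) : Matrix (Fin 2) (Fin 2) ℂ)‖ ≤ r (i + 1))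
    (hρα : 4 * ((((((F.P K).d + 2) * (F.P K).L : ℕ) : ℝ) ^ 2 / 4) * (2 * ((C_B + 1) * α))) ≤ ρr)
    (hρδ : 100 * (((((F.P K).d + 2) * (F.P K).L : ℕ) : ℝ) * ((((F.P K).d - 1 : ℕ) : ℝ) * ((3 * (F.P K).L : ℕ) : ℝ) * (2 * ((C_B + 1) * α)))) ≤ ρr)
    (o m : ℝ) (ho : 0 ≤ o)
    (hOlev : ∀ k, k < K - J →
      2 * ((((F.P K).d : ℕ) : ℝ) * ((3 * (F.P K).L : ℕ) : ℝ)) * (((2 * ε k * (((1 + 4 * (((F.P K).d + 2 : ℕ) : ℝ)) * Real.exp ((((F.P K).d + 2 : ℕ) : ℝ) * (422 + 1616 * (((F.P K).d + 2 : ℕ) : ℝ)) * ∑ j ∈ Finset.range k, (fun l : ℕ => if l < K - J then (((((F.P K).d + 2) * (F.P K).L : ℕ) : ℝ) ^ 2 / 4) * ((C_B + 1) * α * (F.L : ℝ) ^ (2 * l) * ((F.L : ℝ)⁻¹) ^ (2 * (K - J))) else 0) j)) * ((F.P K).L : ℝ) ^ k * ‖X 0‖) + (∑ i ∈ Finset.range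 k, ((1 + 4 * (((F.P K).d + 2 : ℕ) : ℝ)) * Real.exp ((((F.P K).d + 2 : ℕ) : ℝ) * (422 + 1616 * (((F.P K).d + 2 : ℕ) : ℝ)) * ∑ j ∈ Finset.range k, (fun l : ℕ => if l < K - J then (((((F.P K).d + 2) * (F.P K).L : ℕ) : ℝ) ^ 2 / 4) * ((C_B + 1) * α * (F.L : ℝ) ^ (2 * l) * ((F.L : ℝ)⁻¹) ^ (2 * (K - J))) else 0) j)) * ((F.P K).L : ℝ) ^ (k - 1 - i) * ((2 * (67 * (((((F.P K).d + 2) * (F.P K).L : ℕ) : ℝ) * (((((F.P K).d - 1 : ℕ) : ℝ) * ((2 * (F.P K).L : ℕ) : ℝ) * (fun l : ℕ => 2 * ((C_B + 1) * α * (F.L : ℝ) ^ (2 * l) * ((F.L : ℝ)⁻¹) ^ (2 * (K - J)))) i) + (((((F.P K).d - 1 : ℕ) : ℝ) * ((2 * (F.P K).L : ℕ) : ℝ) * (fun l : ℕ => 2 * ((C_B + 1) * α * (F.L : ℝ) ^ (2 * l) * ((F.L : ℝ)⁻¹) ^ (2 * (K - J)))) i) + ((((F.P K).L ^ (k - i)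 : ℕ) : ℝ) * (2 * ε i + (fun l : ℕ => 2 * ((C_B + 1) * α * (F.L : ℝ) ^ (2 * l) * ((F.L : ℝ)⁻¹) ^ (2 * (K - J)))) i)))))) / a₀) * (((1 + 4 * (((F.P K).d + 2 : ℕ) : ℝ)) * Real.exp ((((F.P K).d + 2 : ℕ) : ℝ) * (422 + 1616 * (((F.P K).d + 2 : ℕ) : ℝ)) * ∑ j ∈ Finset.range k, (fun l : ℕ => if l < K - J then (((((F.P K).d + 2) * (F.P K).L : ℕ) : ℝ) ^ 2 / 4) * ((C_B + 1) * α * (F.L : ℝ) ^ (2 * l) * ((F.L : ℝ)⁻¹) ^ (2 * (K - J))) else 0) j)) * ((F.P K).L : ℝ) ^ i))) * ‖X 0‖) + (((1 + 4 * (((F.P K).d + 2 : ℕ) : ℝ)) * Real.exp ((((F.P K).d + 2 : ℕ) : ℝ) * (422 + 1616 * (((F.P K).d + 2 : ℕ) : ℝ)) * ∑ j ∈ Finset.range k, (fun l : ℕ => if l < K - J then (((((F.P K).d + 2) * (F.P K).L : ℕ) : ℝ) ^ 2 / 4) * ((C_B + 1) * α * (F.L : ℝ) ^ (2 * l) * ((F.L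 : ℝ)⁻¹) ^ (2 * (K - J))) else 0) j)) * ((F.P K).L : ℝ) ^ k) * ((F.L : ℝ) ^ k * c₀ k)) + 2 * (∑ i ∈ Finset.range k, ((1 + 4 * (((F.P K).d + 2 : ℕ) : ℝ)) * Real.exp ((((F.P K).d + 2 : ℕ) : ℝ) * (422 + 1616 * (((F.P K).d + 2 : ℕ) : ℝ)) * ∑ j ∈ Finset.range k, (fun l : ℕ => if l < K - J then (((((F.P K).d + 2) * (F.P K).L : ℕ) : ℝ) ^ 2 / 4) * ((C_B + 1) * α * (F.L : ℝ) ^ (2 * l) * ((F.L : ℝ)⁻¹) ^ (2 * (K - J))) else 0) j)) * ((F.P K).L : ℝ) ^ (k - 1 - i) * r (i + 1))) ≤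
      o * ((F.L : ℝ) ^ (2 * k) / (F.L : ℝ) ^ (2 * (K - J))))
    (hMbsq : ∀ i, i < K - J → Mb i ^ 2 ≤ m ^ 2 * ((F.L : ℝ) ^ (2 * i) / (F.L : ℝ) ^ (2 * (K - J))))
    (hMbm : ∀ i, i < K - J → Mb i ≤ m)
    (c : ℝ) (hc0 : 0 ≤ c) (hc4 : 4 * c ≤ 1)
    (hζc : ∀ ℓ : PBond (F.P K) 0, ‖ζ ℓ‖ ≤ c * ((F.L : ℝ)⁻¹) ^ (K - J))
    (Mbar : ℝ) (hM0 : 0 ≤ Mbar) (hM1 : 4 * Mbar ≤ 1)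
    (hM : ∀ s, s < K - J → ∀ b : PBond (F.P K) s, ‖logVec (su2Quat (Averaging.iter (fun k => BlockAveraging.blockAvg (P := F.P K) (j := k) ℰp) s (fun ℓ => expPoint (ζ ℓ) * U₀ ℓ : GaugeField (F.P K) 0 (Matrix.specialUnitaryGroup (Fin 2) ℂ)) b * (Averaging.iter (fun k => BlockAveraging.blockAvg (P := F.P K) (j := k) ℰp) s U₀ b)⁻¹))‖ ≤ Mbar) :
    ∑ t ∈ Finset.range (K - J), (F.L : ℝ) ^ t * (fun t => Cst * ∑ B : PBond (F.P J) 0,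
      ‖(fun p : Plaq (F.P K) (K - J - 1 - t) =>
        if ∃ z₀ : Site (F.P K) 0, (blockIter (K - J) z₀ = (bondShift (F.sitesPerDir_eq (m := F.m) (K := J) (j := 0) (m' := F.m) (K' := K) (j' := K - J) (by omega)) B).src ∨
            blockIter (K - J) z₀ = (bondShift (F.sitesPerDir_eq (m := F.m) (K := J) (j := 0) (m' := F.m) (K' := K) (j' := K - J) (by omega)) B).tgt) ∧
            ∀ κ, (rel (blockIter (K - J - 1 - t) z₀) p.src κ).natAbs ≤ (2 * F.L + 1)
        then dist1 ((GaugeField.plaqHol (Averaging.iter (fun k => BlockAveraging.blockAvg (P := F.P K) (j := k) ℰp) (K - J - 1 - t) U₀) p)⁻¹ *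
          GaugeField.plaqHol (Averaging.iter (fun k => BlockAveraging.blockAvg (P := F.P K) (j := k) ℰp) (K - J - 1 - t)
            (fun ℓ => expPoint (ζ ℓ) * U₀ ℓ : GaugeField (F.P K) 0 (Matrix.specialUnitaryGroup (Fin 2) ℂ))) p)
        else 0)‖ ^ 2) t ≤
      2 * ((2 * Cst * (((5 ^ (F.P K).d : ℕ) : ℝ) ^ 2 * (((2 * ((2 * F.L + 1) + 2) + 1) ^ (F.P K).d * 6 : ℕ) : ℝ) *
              (2 * ((((F.P K).L ^ (F.P K).d : ℕ) : ℝ) - 1) / ((((F.P K).L ^ (F.P K).d : ℕ) : ℝ) - 3)))) * (4 * (F.L : ℝ)⁻¹ * ((F.L : ℝ) ^ (K - J) * ∑ p : Plaq (F.P K) 0,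
                  (1 - reTr ((GaugeField.plaqHol U₀ p)⁻¹ * GaugeField.plaqHol (fun ℓ => expPoint (ζ ℓ) * U₀ ℓ : GaugeField (F.P K) 0 (Matrix.specialUnitaryGroup (Fin 2) ℂ)) p))) + 7 *
      (12 * ((F.P K).d : ℝ) ^ 2 * (2 * ((F.P K).L : ℝ) ^ 2 * (3 * (F.P K).L + 2) + 2 * ((F.P K).L : ℝ) ^ 2 + (48 * (F.P K).L + 24 * ((((F.P K).d + 2) * (F.P K).L : ℕ) : ℝ) + 1616 * ((((F.P K).d + 2) * (F.P K).L : ℕ) : ℝ)) * (((((F.P K).d + 2) * (F.P K).L : ℕ) : ℝ) ^ 2 / 4) +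
        2 * ((((F.P K).d + 2) * (F.P K).L : ℕ) : ℝ) * ((F.L : ℝ) ^ 2)) ^ 2 * (2 * ((C_B + 1) * α)) ^ 2 *
        (∑ t ∈ Finset.range (K - J), (if ht : t < K - J then
          (F.L : ℝ) ^ t * ∑ B : PBond (F.P J) 0,
            ‖(fun ℓ' : PBond (F.P (J + (t + 1))) 0 =>
              if ∃ z : Site (F.P (J + (t + 1))) 0,
                (B14.Eq22Determines.blockIter (t + 1) z = (bondShift (F.sitesPerDir_eq (m := F.m) (K := J) (j := 0) (m' := F.m) (K' := J + (t + 1)) (j' := t + 1) (by omega)) B).src ∨ B14.Eq22Determines.blockIter (t + 1) z = (bondShift (F.sitesPerDir_eq (m := F.m) (K := J) (j := 0) (m' := F.m) (K' := J + (t + 1)) (j' := t + 1) (by omega)) B).tgt) ∧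
                ∀ ν, (B10Eq27TorusAxialLog.rel z ℓ'.src ν).natAbs ≤ 2
              then logVec (su2Quat (descendTo F ℰp (J + (t + 1)) K (by omega) (fun ℓ => expPoint (ζ ℓ) * U₀ ℓ : GaugeField (F.P K) 0 (Matrix.specialUnitaryGroup (Fin 2) ℂ)) ℓ' * (descendTo F ℰp (J + (t + 1)) K (by omega) U₀ ℓ')⁻¹)) else 0)‖ ^ 2
        else 0)) / (F.L : ℝ) +
      (192 * ((F.P K).d : ℝ) ^ 2 *
        (16 * (54 * (((((F.P K).d + 2) * (F.P K).L : ℕ) : ℝ) * (Real.exp a₀ - 1))) * o / (15 * a₀ / 16) ^ 2 + 32 * (54 * (((((F.P K).d + 2) * (F.P K).L : ℕ) : ℝ) * (Real.exp a₀ - 1))) * o / a₀ ^ 2 +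
          ((((F.P K).d + 2) * (F.P K).L : ℕ) : ℝ) ^ 3 * m ^ 2 + 8 * (67 * (((((F.P K).d + 2) * (F.P K).L : ℕ) : ℝ) * ((((F.P K).d - 1 : ℕ) : ℝ) * ((3 * (F.P K).L : ℕ) : ℝ) * (2 * ((C_B + 1) * α))))) * m / a₀ ^ 2) ^ 2 *
        (∑ t ∈ Finset.range (K - J), (if ht : t < K - J then
          (F.L : ℝ) ^ t * ∑ B : PBond (F.P J) 0,
            ‖(fun ℓ' : PBond (F.P (J + (t + 1))) 0 =>
              if ∃ z : Site (F.P (J + (t + 1))) 0,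
                (B14.Eq22Determines.blockIter (t + 1) z = (bondShift (F.sitesPerDir_eq (m := F.m) (K := J) (j := 0) (m' := F.m) (K' := J + (t + 1)) (j' := t + 1) (by omega)) B).src ∨ B14.Eq22Determines.blockIter (t + 1) z = (bondShift (F.sitesPerDir_eq (m := F.m) (K := J) (j := 0) (m' := F.m) (K' := J + (t + 1)) (j' := t + 1) (by omega)) B).tgt) ∧
                ∀ ν, (B10Eq27TorusAxialLog.rel z ℓ'.src ν).natAbs ≤ 2
              then logVec (su2Quat (descendTo F ℰp (J + (t + 1)) K (by omega) (fun ℓ => expPoint (ζ ℓ) * U₀ ℓ : GaugeField (F.P K) 0 (Matrix.specialUnitaryGroup (Fin 2) ℂ)) ℓ' * (descendTo F ℰp (J + (t + 1)) K (by omega) U₀ ℓ')⁻¹)) else 0)‖ ^ 2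
        else 0)) / (F.L : ℝ)) +
      3 * ((768 * c ^ 2 * (F.L : ℝ)) *
        (((F.L : ℝ)⁻¹) ^ (K - J) * ∑ ℓ : PBond (F.P K) 0, ‖ζ ℓ‖ ^ 2 +
          (F.L : ℝ) ^ (K - J) * ∑ p : Plaq (F.P K) 0,
            (1 - reTr ((GaugeField.plaqHol U₀ p)⁻¹ * GaugeField.plaqHol (fun ℓ => expPoint (ζ ℓ) * U₀ ℓ : GaugeField (F.P K) 0 (Matrix.specialUnitaryGroup (Fin 2) ℂ)) p))))))) +
      2 * ((256 * Cst * Mbar ^ 2 * ((2 * (F.P J).d * (2 * 3 + 1) ^ (F.P J).d : ℕ) : ℝ)) * (∑ t ∈ Finset.range (K - J), (if ht : t < K - J then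
          (F.L : ℝ) ^ t * ∑ B : PBond (F.P J) 0,
            ‖(fun ℓ' : PBond (F.P (J + (t + 1))) 0 =>
              if ∃ z : Site (F.P (J + (t + 1))) 0,
                (B14.Eq22Determines.blockIter (t + 1) z = (bondShift (F.sitesPerDir_eq (m := F.m) (K := J) (j := 0) (m' := F.m) (K' := J + (t + 1)) (j' := t + 1) (by omega)) B).src ∨ B14.Eq22Determines.blockIter (t + 1) z = (bondShift (F.sitesPerDir_eq (m := F.m) (K := J) (j := 0) (m' := F.m) (K' := J + (t + 1)) (j' := t + 1) (by omega)) B).tgt) ∧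
                ∀ ν, (B10Eq27TorusAxialLog.rel z ℓ'.src ν).natAbs ≤ 2
              then logVec (su2Quat (descendTo F ℰp (J + (t + 1)) K (by omega) (fun ℓ => expPoint (ζ ℓ) * U₀ ℓ : GaugeField (F.P K) 0 (Matrix.specialUnitaryGroup (Fin 2) ℂ)) ℓ' * (descendTo F ℰp (J + (t + 1)) K (by omega) U₀ ℓ')⁻¹)) else 0)‖ ^ 2
        else 0))) := by
  obtain ⟨hO0, hOSC⟩ := oscKnot_letters F U₀ X C_B α hCB hα hBKG h24 hSU hρ0 hρr ha0 ha hρα ε r c₀ hε0 hεnn hε hwin hc₀nn hc₀ hr0 hr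
  exact c1Budget_profiled F hJK Cst hCst U₀ ζ X hXdef Mg hMg hMg4 C_B α hCB hα hBKG h24 hSU hρ0 hρr ha0 ha Mb hMb0 hMb hMb16
    (fun n : ℕ => match n with
          | 0 => (0 : ℝ)
          | kk + 1 => 2 * ((((F.P K).d : ℕ) : ℝ) * ((3 * (F.P K).L : ℕ) : ℝ)) * (((2 * ε kk * (((1 + 4 * (((F.P K).d + 2 : ℕ) : ℝ)) * Real.exp ((((F.P K).d + 2 : ℕ) : ℝ) * (422 + 1616 * (((F.P K).d + 2 : ℕ) : ℝ)) * ∑ j ∈ Finset.range kk, (fun l : ℕ => if l < K - J then (((((F.P K).d + 2) * (F.P K).L : ℕ) : ℝ) ^ 2 / 4) * ((C_B + 1) * α * (F.L : ℝ) ^ (2 * l) * ((F.L : ℝ)⁻¹) ^ (2 * (K - J))) else 0) j)) * ((F.P K).L : ℝ) ^ kk * ‖X 0‖) + (∑ i ∈ Finset.range kk, ((1 + 4 * (((F.P K).d + 2 : ℕ) : ℝ)) * Real.exp ((((F.P K).d + 2 : ℕ) : ℝ) * (422 + 1616 * (((F.P K).d + 2 : ℕ) : ℝ)) * ∑ j ∈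 Finset.range kk, (fun l : ℕ => if l < K - J then (((((F.P K).d + 2) * (F.P K).L : ℕ) : ℝ) ^ 2 / 4) * ((C_B + 1) * α * (F.L : ℝ) ^ (2 * l) * ((F.L : ℝ)⁻¹) ^ (2 * (K - J))) else 0) j)) * ((F.P K).L : ℝ) ^ (kk - 1 - i) * ((2 * (67 * (((((F.P K).d + 2) * (F.P K).L : ℕ) : ℝ) * (((((F.P K).d - 1 : ℕ) : ℝ) * ((2 * (F.P K).L : ℕ) : ℝ) * (fun l : ℕ => 2 * ((C_B + 1) * α * (F.L : ℝ) ^ (2 * l) * ((F.L : ℝ)⁻¹) ^ (2 * (K - J)))) i) + (((((F.P K).d - 1 : ℕ) : ℝ) * ((2 * (F.P K).L : ℕ) : ℝ) * (fun l : ℕ => 2 * ((C_B + 1) * α * (F.L : ℝ) ^ (2 * l) * ((F.L : ℝ)⁻¹) ^ (2 * (K - J)))) i) + ((((F.P K).L ^ (kk - i) : ℕ) : ℝ) * (2 * ε i + (fun l : ℕ => 2 * ((C_B + 1) * α * (F.L : ℝ) ^ (2 * l) * ((F.L : ℝ)⁻¹) ^ (2 * (K - J)))) i)))))) / a₀) *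 (((1 + 4 * (((F.P K).d + 2 : ℕ) : ℝ)) * Real.exp ((((F.P K).d + 2 : ℕ) : ℝ) * (422 + 1616 * (((F.P K).d + 2 : ℕ) : ℝ)) * ∑ j ∈ Finset.range kk, (fun l : ℕ => if l < K - J then (((((F.P K).d + 2) * (F.P K).L : ℕ) : ℝ) ^ 2 / 4) * ((C_B + 1) * α * (F.L : ℝ) ^ (2 * l) * ((F.L : ℝ)⁻¹) ^ (2 * (K - J))) else 0) j)) * ((F.P K).L : ℝ) ^ i))) * ‖X 0‖) + (((1 + 4 * (((F.P K).d + 2 : ℕ) : ℝ)) * Real.exp ((((F.P K).d + 2 : ℕ) : ℝ) * (422 + 1616 * (((F.P K).d + 2 : ℕ) : ℝ)) * ∑ j ∈ Finset.range kk, (fun l : ℕ => if l < K - J then (((((F.P K).d + 2) * (F.P K).L : ℕ) : ℝ) ^ 2 / 4) * ((C_B + 1) * α * (F.L : ℝ) ^ (2 * l) * ((F.L : ℝ)⁻¹) ^ (2 * (K - J))) else 0) j)) * ((F.P K).L : ℝ) ^ kk) * ((F.L : ℝ) ^ kk * c₀ kk)) + 2 * (∑ i ∈ Finset.range kk, ((1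 + 4 * (((F.P K).d + 2 : ℕ) : ℝ)) * Real.exp ((((F.P K).d + 2 : ℕ) : ℝ) * (422 + 1616 * (((F.P K).d + 2 : ℕ) : ℝ)) * ∑ j ∈ Finset.range kk, (fun l : ℕ => if l < K - J then (((((F.P K).d + 2) * (F.P K).L : ℕ) : ℝ) ^ 2 / 4) * ((C_B + 1) * α * (F.L : ℝ) ^ (2 * l) * ((F.L : ℝ)⁻¹) ^ (2 * (K - J))) else 0) j)) * ((F.P K).L : ℝ) ^ (kk - 1 - i) * r (i + 1))))
    hO0 hOSC hρα hρδ o m ho hOlev hMbsq hMbm c hc0 hc4 hζc Mbar hM0 hM1 hM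

end Summit.QuantumFields.YangMills.Theorems.FluctuationComparisonRegPrIntLS2BetaCurlBudgetOscKnot

end
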